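import Summits.QuantumFields.QCD.Theorems.QuarksAsStableActionCriticalLineDiamagnetismCellDefs
import Summits.QuantumFields.QCD.Theorems.QuarksAsStableActionCriticalLineDiamagnetismCellNorms

/-!
# Stub `cellInvert` of the B6 cell lemma (crux `stmt-QuantumFields-9734`, line `Sketch`, Route B)

Sub-problem context: `Summits/QuantumFields/QCD/Statement.lean`; crux decl
`Summit.QuantumFields.QCD.Theses.QuarksAsStableAction.CriticalLineDiamagnetism`; registered stub `cellInvert`
(Neumann-series control of the checkerboard perturbation), feeding `cellLemma` of `stub_heavyFrequencyGain`.

For the checkerboard field `chk n P` of one plaquette `P ∈ U(3)` on `(ℤ/2n)²` (file `…CellDefs`): the free operator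
`D_1` is invertible, `D_P = D_1 (1 + X)` with `X = D_1⁻¹ (D_P − D_1)`, and every eigenvalue `μ` of `X` has
`‖μ‖ ≤ min (13/25, (13/50)·√(2 def P))`, `def P = 3 − Re tr P`.

Proof (all in `ℓ²(sites × colour × spin)`, vector level): `(M_ω − 2)‖v‖ ≤ ‖D_1 v‖` with `M_ω − 2 ≥ 3.89` is
`cellNorms` (file `…CellNorms`); `D_P − D_1` is a single-direction hop operator whose colour parts are `±(U − 1)`,
`U ∈ {P, P⁻¹, 1}` (block form `freqOpR_mulVec_apply`), so by `sum_norm_sq_hop_le` it has `ℓ²`-bound `C` whenever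
`Σ‖(P − 1) w‖², Σ‖(Pᴴ − 1) w‖² ≤ C Σ‖w‖²`; this holds with `C = 4` (triangle inequality) and with `C = ‖P − 1‖_F² = 2 def P`
(Schur/Frobenius, `tr((P − 1)ᴴ(P − 1)) = 6 − 2 Re tr P`).  For an eigenvector, `(D_P − D_1) v = μ D_1 v`, whence
`‖μ‖ (M_ω − 2) ≤ √C` and `1/3.89 ≤ 13/50`.
-/

noncomputable section

open scoped BigOperators Matrix ComplexConjugate Kronecker
open Matrix Complex
open Literature.MathematicalPhysics.QuantumLattice
open Summit.QuantumFields.QCD.Cruxes.CriticalLineDiamagnetism.ChessboardCellGain.FrequencyDiamagnetism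

namespace Summit.QuantumFields.QCD.Cruxes.CriticalLineDiamagnetism.ChessboardCellGain

namespace Cell

/-! ### Link-difference bounds -/

/-- Seam signs do not change `Σ‖·‖²`. -/
theorem sum_norm_sq_sign_smul_mulVec {κ : Type} [Fintype κ] (t : Prop) [Decidable t] (E : Matrix κ κ ℂ) (w : κ → ℂ) :
    (∑ c, ‖(((if t then (-1 : ℂ) else 1) • E) *ᵥ w) c‖ ^ 2 : ℝ) = ∑ c, ‖(E *ᵥ w) c‖ ^ 2 := by
  split_ifs <;> simp [Matrix.neg_mulVec]

/-- The crude bound `Σ‖(W − 1) w‖² ≤ 4 Σ‖w‖²` for an isometry `W`. -/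
theorem sum_norm_sq_isometry_sub_one_le {κ : Type} [Fintype κ] [DecidableEq κ] (W : Matrix κ κ ℂ) (hW : Wᴴ * W = 1)
    (w : κ → ℂ) : (∑ c, ‖((W - 1) *ᵥ w) c‖ ^ 2 : ℝ) ≤ 4 * ∑ c, ‖w c‖ ^ 2 := by
  have hiso := sum_norm_sq_mulVec_of_isometry W hW w
  have hpt : ∀ c, ‖((W - 1) *ᵥ w) c‖ ^ 2 ≤ 2 * ‖(W *ᵥ w) c‖ ^ 2 + 2 * ‖w c‖ ^ 2 := by
    intro c
    rw [Matrix.sub_mulVec, Matrix.one_mulVec, Pi.sub_apply]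
    nlinarith [norm_sub_le ((W *ᵥ w) c) (w c), norm_nonneg ((W *ᵥ w) c - w c), norm_nonneg ((W *ᵥ w) c),
      norm_nonneg (w c), sq_nonneg (‖(W *ᵥ w) c‖ - ‖w c‖)]
  calc (∑ c, ‖((W - 1) *ᵥ w) c‖ ^ 2 : ℝ) ≤ ∑ c, (2 * ‖(W *ᵥ w) c‖ ^ 2 + 2 * ‖w c‖ ^ 2) :=
        Finset.sum_le_sum fun c _ => hpt c
    _ = 4 * ∑ c, ‖w c‖ ^ 2 := by rw [Finset.sum_add_distrib, ← Finset.mul_sum, ← Finset.mul_sum, hiso]; ring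

/-- The Frobenius (Schur) bound `Σ‖E w‖² ≤ (Σ_{c,d} ‖E_{cd}‖²) Σ‖w‖²`. -/
theorem sum_norm_sq_mulVec_le_frobenius {κ : Type} [Fintype κ] (E : Matrix κ κ ℂ) (w : κ → ℂ) :
    (∑ c, ‖(E *ᵥ w) c‖ ^ 2 : ℝ) ≤ (∑ c, ∑ d, ‖E c d‖ ^ 2) * ∑ d, ‖w d‖ ^ 2 := by
  rw [Finset.sum_mul]
  refine Finset.sum_le_sum fun c _ => ?_
  have h1 : ‖(E *ᵥ w) c‖ ≤ ∑ d, ‖E c d‖ * ‖w d‖ := by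
    simp only [Matrix.mulVec, dotProduct]
    exact (norm_sum_le _ _).trans (le_of_eq (Finset.sum_congr rfl fun d _ => norm_mul _ _))
  calc ‖(E *ᵥ w) c‖ ^ 2 ≤ (∑ d, ‖E c d‖ * ‖w d‖) ^ 2 := pow_le_pow_left₀ (norm_nonneg _) h1 2
    _ ≤ (∑ d, ‖E c d‖ ^ 2) * ∑ d, ‖w d‖ ^ 2 := Finset.sum_mul_sq_le_sq_mul_sq _ _ _

/-- `Σ_{c,d} ‖E_{cd}‖² = tr(Eᴴ E)` (as a complex number). -/
theorem frobenius_sq_eq_trace {κ : Type} [Fintype κ] (E : Matrix κ κ ℂ) :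
    (((∑ c, ∑ d, ‖E c d‖ ^ 2 : ℝ)) : ℂ) = (Eᴴ * E).trace := by
  rw [Finset.sum_comm]
  simp only [Matrix.trace, Matrix.diag, Matrix.mul_apply, Matrix.conjTranspose_apply, Complex.ofReal_sum,
    Complex.ofReal_pow]
  refine Finset.sum_congr rfl fun d _ => Finset.sum_congr rfl fun c _ => ?_
  rw [Complex.star_def, ← Complex.normSq_eq_conj_mul_self, Complex.normSq_eq_norm_sq, Complex.ofReal_pow]

/-- For an isometry `W` of `ℂ³`: `‖W − 1‖_F² = 2 (3 − Re tr W)`. -/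
theorem frobenius_sq_isometry_sub_one (W : Matrix (Fin 3) (Fin 3) ℂ) (hW : Wᴴ * W = 1) :
    (∑ c, ∑ d, ‖(W - 1) c d‖ ^ 2 : ℝ) = 2 * (3 - W.trace.re) := by
  have h := frobenius_sq_eq_trace (W - 1)
  rw [Matrix.conjTranspose_sub, Matrix.conjTranspose_one, Matrix.sub_mul, Matrix.mul_sub, Matrix.mul_sub,
    Matrix.one_mul, Matrix.mul_one, Matrix.one_mul, hW, Matrix.trace_sub, Matrix.trace_sub, Matrix.trace_sub,
    Matrix.trace_one, Matrix.trace_conjTranspose, Fintype.card_fin] at h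
  have h' := congrArg Complex.re h
  rw [Complex.ofReal_re] at h'
  rw [h']
  simp only [Complex.sub_re, Complex.star_def, Complex.conj_re, Complex.natCast_re]
  push_cast
  ring

/-- The Frobenius bound for the link difference of a unitary `P`: `Σ‖(P − 1) w‖² ≤ 2 def(P) Σ‖w‖²`, also for `Pᴴ`. -/
theorem sum_norm_sq_sub_one_mulVec_le_defi (P : Matrix.unitaryGroup (Fin 3) ℂ) (w : Fin 3 → ℂ) :
    (∑ c, ‖(((P : Matrix (Fin 3) (Fin 3) ℂ) - 1) *ᵥ w) c‖ ^ 2 : ℝ) ≤ 2 * defi P * ∑ c, ‖w c‖ ^ 2 ∧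
    (∑ c, ‖((star (P : Matrix (Fin 3) (Fin 3) ℂ) - 1) *ᵥ w) c‖ ^ 2 : ℝ) ≤ 2 * defi P * ∑ c, ‖w c‖ ^ 2 := by
  have h1 : (P : Matrix (Fin 3) (Fin 3) ℂ)ᴴ * (P : Matrix (Fin 3) (Fin 3) ℂ) = 1 := Matrix.UnitaryGroup.star_mul_self P
  have h2 : (star (P : Matrix (Fin 3) (Fin 3) ℂ))ᴴ * star (P : Matrix (Fin 3) (Fin 3) ℂ) = 1 := by
    rw [Matrix.star_eq_conjTranspose, Matrix.conjTranspose_conjTranspose]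
    exact Unitary.coe_mul_star_self P
  constructor
  · have h := sum_norm_sq_mulVec_le_frobenius ((P : Matrix (Fin 3) (Fin 3) ℂ) - 1) w
    rwa [frobenius_sq_isometry_sub_one _ h1] at h
  · have h := sum_norm_sq_mulVec_le_frobenius (star (P : Matrix (Fin 3) (Fin 3) ℂ) - 1) w
    rw [frobenius_sq_isometry_sub_one _ h2, Matrix.star_eq_conjTranspose, Matrix.trace_conjTranspose,
      Complex.star_def, Complex.conj_re] at h
    exact h

/-- The crude bound for the link difference of a unitary `P`: `Σ‖(P − 1) w‖² ≤ 4 Σ‖w‖²`, also for `Pᴴ`. -/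
theorem sum_norm_sq_sub_one_mulVec_le_four (P : Matrix.unitaryGroup (Fin 3) ℂ) (w : Fin 3 → ℂ) :
    (∑ c, ‖(((P : Matrix (Fin 3) (Fin 3) ℂ) - 1) *ᵥ w) c‖ ^ 2 : ℝ) ≤ 4 * ∑ c, ‖w c‖ ^ 2 ∧
    (∑ c, ‖((star (P : Matrix (Fin 3) (Fin 3) ℂ) - 1) *ᵥ w) c‖ ^ 2 : ℝ) ≤ 4 * ∑ c, ‖w c‖ ^ 2 := by
  refine ⟨sum_norm_sq_isometry_sub_one_le _ (Matrix.UnitaryGroup.star_mul_self P) w,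
    sum_norm_sq_isometry_sub_one_le _ ?_ w⟩
  rw [Matrix.star_eq_conjTranspose, Matrix.conjTranspose_conjTranspose]
  exact Unitary.coe_mul_star_self P

/-- Kronecker blocks are linear in the colour factor: `((σU) ⊗ R) w − ((σW) ⊗ R) w = ((σ(U − W)) ⊗ R) w`. -/
theorem kronecker_smul_sub_mulVec {α β : Type} [Fintype α] [Fintype β] (σ : ℂ) (U W : Matrix α α ℂ) (R : Matrix β β ℂ)
    (w : α × β → ℂ) (k : α × β) :
    (((σ • U) ⊗ₖ R) *ᵥ w) k - (((σ • W) ⊗ₖ R) *ᵥ w) k = (((σ • (U - W)) ⊗ₖ R) *ᵥ w) k := by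
  simp only [Matrix.mulVec, dotProduct, Matrix.kroneckerMap_apply, Matrix.smul_apply, Matrix.sub_apply, smul_eq_mul,
    ← Finset.sum_sub_distrib]
  exact Finset.sum_congr rfl fun _ _ => by ring

end Cell

open Cell

/-- **Stub `cellInvert`** (B6, Neumann-series control of the checkerboard perturbation): the free operator `D_1` is
invertible, `D_P = D_1 (1 + X)`, and every eigenvalue `μ` of `X = D_1⁻¹(D_P − D_1)` satisfies
`‖μ‖ ≤ min(13/25, (13/50)·√(2 def P))`.  Proof: `(M_ω − 2)‖v‖ ≤ ‖D_1 v‖` with `M_ω − 2 ≥ 3.89` (`cellNorms`), and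
`D_P − D_1` is a one-direction hop operator whose colour parts are `±(U − 1)`, `U ∈ {P, P⁻¹, 1}`, so
`‖(D_P − D_1) v‖ ≤ min(2, ‖P − 1‖_F) ‖v‖` with `‖P − 1‖_F² = 2 def P`; for an eigenvector, `(D_P − D_1) v = μ D_1 v`. -/
theorem cellInvert : ∀ (n : ℕ) [NeZero n] (m : ℝ), |m| ≤ 1 / 10 → ∀ ω₀ ω₁ : ℝ, Real.cos ω₀ ≤ -(199 / 200) → Real.cos ω₁ ≤ -(199 / 200) → ∀ (P : Matrix.unitaryGroup (Fin 3) ℂ), IsUnit (D1 n m ω₀ ω₁).det ∧ DP n P m ω₀ ω₁ = D1 n m ω₀ ω₁ * (1 + X n P m ω₀ ω₁) ∧ ∀ μ : ℂ, Module.End.HasEigenvalue (Matrix.toLin' (X n P m ω₀ ω₁)) μ → ‖μ‖ ≤ min (13 / 25) (13 / 50 * Real.sqrt (2 * defi P)) := by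
  intro n _ m hm ω₀ ω₁ hω₀ hω₁ P
  have hM : (389 / 100 : ℝ) ≤ m + 4 - Real.cos ω₀ - Real.cos ω₁ - 2 := by
    have := (abs_le.mp hm).1
    linarith
  have hγ : ∀ μ : Fin 4, (euclideanGamma μ)ᴴ = euclideanGamma μ := fun μ => (euclideanGamma_isHermitian μ).eq
  -- the lower bound for `D_1`
  have hlow : ∀ v : (ZMod (2 * n) × ZMod (2 * n)) × Fin 3 × Fin 4 → ℂ,
      (m + 4 - Real.cos ω₀ - Real.cos ω₁ - 2) *
        ‖(WithLp.toLp 2 v : EuclideanSpace ℂ ((ZMod (2 * n) × ZMod (2 * n)) × Fin 3 × Fin 4))‖ ≤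
      ‖(WithLp.toLp 2 (D1 n m ω₀ ω₁ *ᵥ v) : EuclideanSpace ℂ ((ZMod (2 * n) × ZMod (2 * n)) × Fin 3 × Fin 4))‖ :=
    fun v => cellNorms (2 * n) (2 * n) euclideanGamma hγ euclideanGamma_mul_self _ m ω₀ ω₁ v
  -- injectivity, hence invertibility
  have hinj : Function.Injective (D1 n m ω₀ ω₁).mulVec := by
    intro v w hvw
    have h := hlow (v - w)
    rw [Matrix.mulVec_sub, hvw, sub_self, WithLp.toLp_zero, norm_zero] at h
    have h0 : ‖(WithLp.toLp 2 (v - w) : EuclideanSpace ℂ ((ZMod (2 * n) × ZMod (2 * n)) × Fin 3 × Fin 4))‖ ≤ 0 :=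
      le_of_mul_le_mul_left (by rw [mul_zero]; exact h) (by linarith)
    have h1 := norm_le_zero_iff.mp h0
    rwa [WithLp.toLp_eq_zero, sub_eq_zero] at h1
  have hdet : IsUnit (D1 n m ω₀ ω₁).det :=
    (Matrix.isUnit_iff_isUnit_det _).mp (Matrix.mulVec_injective_iff_isUnit.mp hinj)
  refine ⟨hdet, ?_, ?_⟩
  · rw [X, Matrix.mul_add, Matrix.mul_one, Matrix.mul_nonsing_inv_cancel_left _ _ hdet]
    abel
  intro μ hμ
  obtain ⟨v, hv⟩ := hμ.exists_hasEigenvector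
  have hv0 : v ≠ 0 := hv.2
  have hXv : X n P m ω₀ ω₁ *ᵥ v = μ • v := by
    have := hv.apply_eq_smul
    rwa [Matrix.toLin'_apply] at this
  have hΔ : (DP n P m ω₀ ω₁ - D1 n m ω₀ ω₁) *ᵥ v = μ • (D1 n m ω₀ ω₁ *ᵥ v) := by
    have h : D1 n m ω₀ ω₁ *ᵥ (X n P m ω₀ ω₁ *ᵥ v) = (DP n P m ω₀ ω₁ - D1 n m ω₀ ω₁) *ᵥ v := by
      rw [Matrix.mulVec_mulVec, X, Matrix.mul_nonsing_inv_cancel_left _ _ hdet]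
    rw [← h, hXv, Matrix.mulVec_smul]
  have hvpos : 0 < ‖(WithLp.toLp 2 v : EuclideanSpace ℂ ((ZMod (2 * n) × ZMod (2 * n)) × Fin 3 × Fin 4))‖ :=
    norm_pos_iff.mpr (by rwa [Ne, WithLp.toLp_eq_zero])
  -- ‖(D_P − D_1) v‖ = ‖μ‖ ‖D_1 v‖ ≥ ‖μ‖ (M − 2) ‖v‖
  have hkey : ‖μ‖ * ((m + 4 - Real.cos ω₀ - Real.cos ω₁ - 2) *
      ‖(WithLp.toLp 2 v : EuclideanSpace ℂ ((ZMod (2 * n) × ZMod (2 * n)) × Fin 3 × Fin 4))‖) ≤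
      ‖(WithLp.toLp 2 ((DP n P m ω₀ ω₁ - D1 n m ω₀ ω₁) *ᵥ v) :
        EuclideanSpace ℂ ((ZMod (2 * n) × ZMod (2 * n)) × Fin 3 × Fin 4))‖ := by
    rw [hΔ, WithLp.toLp_smul, norm_smul]
    exact mul_le_mul_of_nonneg_left (hlow v) (norm_nonneg _)
  -- block form of the perturbation `D_P − D_1`
  obtain ⟨hP₂, hQ₂, hPP₂, hQQ₂, hPQ₂, hPQ1₂⟩ := half_one_sub_add_proj (euclideanGamma 2) (hγ 2) (euclideanGamma_mul_self 2)
  have hΔform : ∀ (x : ZMod (2 * n) × ZMod (2 * n)) (k : Fin 3 × Fin 4),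
      ((DP n P m ω₀ ω₁ - D1 n m ω₀ ω₁) *ᵥ v) (x, k) =
        -((((((if x.1 = -1 then (-1 : ℂ) else 1) • ((chk n P x.1 x.2 2 : Matrix (Fin 3) (Fin 3) ℂ) - 1)) ⊗ₖ
            ((1 / 2 : ℂ) • (1 - euclideanGamma 2))) *ᵥ fun k => v ((x.1 + 1, x.2), k)) +
          ((((if x.1 - 1 = -1 then (-1 : ℂ) else 1) • (star (chk n P (x.1 - 1) x.2 2 : Matrix (Fin 3) (Fin 3) ℂ) - 1)) ⊗ₖ
            ((1 / 2 : ℂ) • (1 + euclideanGamma 2))) *ᵥ fun k => v ((x.1 - 1, x.2), k)) : Fin 3 × Fin 4 → ℂ) k) := by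
    intro x k
    rw [Matrix.sub_mulVec, Pi.sub_apply, DP, D1, freqOpR_mulVec_apply, freqOpR_mulVec_apply]
    simp only [Pi.add_apply, cellDefs_anchor, OneMemClass.coe_one, star_one]
    linear_combination (kronecker_smul_sub_mulVec (if x.1 = -1 then (-1 : ℂ) else 1)
        (chk n P x.1 x.2 2 : Matrix (Fin 3) (Fin 3) ℂ) 1 ((1 / 2 : ℂ) • (1 - euclideanGamma 2))
        (fun k => v ((x.1 + 1, x.2), k)) k).symm +
      (kronecker_smul_sub_mulVec (if x.1 - 1 = -1 then (-1 : ℂ) else 1)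
        (star (chk n P (x.1 - 1) x.2 2 : Matrix (Fin 3) (Fin 3) ℂ)) 1 ((1 / 2 : ℂ) • (1 + euclideanGamma 2))
        (fun k => v ((x.1 - 1, x.2), k)) k).symm
  -- the perturbation bound with a generic constant
  let e₁ : Equiv.Perm (ZMod (2 * n) × ZMod (2 * n)) := ⟨fun x => (x.1 + 1, x.2), fun x => (x.1 - 1, x.2),
    fun x => by simp, fun x => by simp⟩
  have hΔb : ∀ C : ℝ,
      (∀ w : Fin 3 → ℂ, (∑ c, ‖(((P : Matrix (Fin 3) (Fin 3) ℂ) - 1) *ᵥ w) c‖ ^ 2 : ℝ) ≤ C * ∑ c, ‖w c‖ ^ 2) →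
      (∀ w : Fin 3 → ℂ, (∑ c, ‖((star (P : Matrix (Fin 3) (Fin 3) ℂ) - 1) *ᵥ w) c‖ ^ 2 : ℝ) ≤ C * ∑ c, ‖w c‖ ^ 2) →
      (∀ w : Fin 3 → ℂ, (0 : ℝ) ≤ C * ∑ c, ‖w c‖ ^ 2) →
      ‖(WithLp.toLp 2 ((DP n P m ω₀ ω₁ - D1 n m ω₀ ω₁) *ᵥ v) :
        EuclideanSpace ℂ ((ZMod (2 * n) × ZMod (2 * n)) × Fin 3 × Fin 4))‖ ^ 2 ≤
      C * ‖(WithLp.toLp 2 v : EuclideanSpace ℂ ((ZMod (2 * n) × ZMod (2 * n)) × Fin 3 × Fin 4))‖ ^ 2 := by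
    intro C hC1 hC2 hC0
    have hU : ∀ (x : ZMod (2 * n) × ZMod (2 * n)) (w : Fin 3 → ℂ),
        (∑ c, ‖(((if x.1 = -1 then (-1 : ℂ) else 1) • ((chk n P x.1 x.2 2 : Matrix (Fin 3) (Fin 3) ℂ) - 1)) *ᵥ w) c‖ ^ 2 : ℝ)
          ≤ C * ∑ c, ‖w c‖ ^ 2 := by
      intro x w
      rw [sum_norm_sq_sign_smul_mulVec]
      simp only [chk, true_and]
      split_ifs
      · exact hC1 w
      · rw [Matrix.UnitaryGroup.inv_val]
        exact hC2 w
      · simpa using hC0 w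
    have hV : ∀ (x : ZMod (2 * n) × ZMod (2 * n)) (w : Fin 3 → ℂ),
        (∑ c, ‖(((if x.1 - 1 = -1 then (-1 : ℂ) else 1) •
          (star (chk n P (x.1 - 1) x.2 2 : Matrix (Fin 3) (Fin 3) ℂ) - 1)) *ᵥ w) c‖ ^ 2 : ℝ) ≤ C * ∑ c, ‖w c‖ ^ 2 := by
      intro x w
      rw [sum_norm_sq_sign_smul_mulVec]
      simp only [chk, true_and]
      split_ifs
      · exact hC2 w
      · rw [Matrix.UnitaryGroup.inv_val, star_star]
        exact hC1 w
      · simpa using hC0 w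
    rw [EuclideanSpace.norm_sq_eq, EuclideanSpace.norm_sq_eq]
    dsimp only
    rw [Fintype.sum_prod_type (α₁ := ZMod (2 * n) × ZMod (2 * n)) (α₂ := Fin 3 × Fin 4)]
    simp only [hΔform, norm_neg]
    exact sum_norm_sq_hop_le e₁ _ _ _ _ hP₂ hQ₂ hPP₂ hQQ₂ hPQ₂ hPQ1₂ C hU hV v
  have hmono : ‖μ‖ * (389 / 100) ≤ ‖μ‖ * (m + 4 - Real.cos ω₀ - Real.cos ω₁ - 2) :=
    mul_le_mul_of_nonneg_left hM (norm_nonneg μ)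
  refine le_min ?_ ?_
  · -- crude bound: ‖(D_P − D_1) v‖ ≤ 2 ‖v‖
    have h4 := hΔb 4 (fun w => (sum_norm_sq_sub_one_mulVec_le_four P w).1)
      (fun w => (sum_norm_sq_sub_one_mulVec_le_four P w).2)
      (fun w => mul_nonneg (by norm_num) (Finset.sum_nonneg fun c _ => sq_nonneg _))
    have h2 : ‖(WithLp.toLp 2 ((DP n P m ω₀ ω₁ - D1 n m ω₀ ω₁) *ᵥ v) :
        EuclideanSpace ℂ ((ZMod (2 * n) × ZMod (2 * n)) × Fin 3 × Fin 4))‖ ≤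
        2 * ‖(WithLp.toLp 2 v : EuclideanSpace ℂ ((ZMod (2 * n) × ZMod (2 * n)) × Fin 3 × Fin 4))‖ :=
      le_of_sq_le_sq (by rw [mul_pow]; linarith) (by positivity)
    have h3 : ‖μ‖ * (m + 4 - Real.cos ω₀ - Real.cos ω₁ - 2) ≤ 2 :=
      le_of_mul_le_mul_right (by linarith [hkey.trans h2]) hvpos
    linarith
  · -- fine bound: ‖(D_P − D_1) v‖ ≤ √(2 def P) ‖v‖
    have hd := hΔb (2 * defi P) (fun w => (sum_norm_sq_sub_one_mulVec_le_defi P w).1)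
      (fun w => (sum_norm_sq_sub_one_mulVec_le_defi P w).2)
      (fun w => le_trans (Finset.sum_nonneg fun c _ => sq_nonneg _) (sum_norm_sq_sub_one_mulVec_le_defi P w).1)
    have hC : 0 ≤ 2 * defi P :=
      le_of_mul_le_mul_right (by rw [zero_mul]; exact (sq_nonneg _).trans hd) (by positivity)
    have h2 : ‖(WithLp.toLp 2 ((DP n P m ω₀ ω₁ - D1 n m ω₀ ω₁) *ᵥ v) :
        EuclideanSpace ℂ ((ZMod (2 * n) × ZMod (2 * n)) × Fin 3 × Fin 4))‖ ≤
        Real.sqrt (2 * defi P) * ‖(WithLp.toLp 2 v : EuclideanSpace ℂ ((ZMod (2 * n) × ZMod (2 * n)) × Fin 3 × Fin 4))‖ :=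
      le_of_sq_le_sq (by rw [mul_pow, Real.sq_sqrt hC]; exact hd) (by positivity)
    have h3 : ‖μ‖ * (m + 4 - Real.cos ω₀ - Real.cos ω₁ - 2) ≤ Real.sqrt (2 * defi P) :=
      le_of_mul_le_mul_right (by linarith [hkey.trans h2]) hvpos
    nlinarith [Real.sqrt_nonneg (2 * defi P), norm_nonneg μ]

end Summit.QuantumFields.QCD.Cruxes.CriticalLineDiamagnetism.ChessboardCellGain

end
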